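/-
Copyright (c) 2026 the pub-hodgecm-mathlib formalisation cell (harness21).  Prover seat hodgecm-mathlib-K2Liu-p01 (g8), Track B «K2-LIT»,
#184♮ = hLiu418 = `stmt-HodgeConjecture-24832`; #42S organ S1 ROAD W, LAST-FILE letter (K3) of the decomposition (bus 12:4xZ): the `Δ⁻`-coordinate `κ₀` of ★ p860172 is a
HOMEOMORPHISM (a continuous `L⁺_v`-linear equivalence) — so the pulled-back boxes∕cells `κ⁻¹(S_i²)`, `κ⁻¹(cell_m)` are compact open (witnesses ARE Schwartz–Bruhat,
`hQm` of ★ (J) holds).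
-/
import Summits.HodgeConjecture.HodgeConjecture.Theorems.K2LiuYModelDeltaMinusCoordinate   -- ★ κ₀: `phi_add`, `phi_psi`, `psi_phi`
import Mathlib.Topology.Algebra.Module.FiniteDimension
import HarnessLib

/-!
# Crux `HLiu418`, #42S-S1 ROAD W, letter (K3): `κ₀ : Y ≃L[L⁺_v] (E ⊗ L⁺_v)ⁿ` — the `Δ⁻`-coordinate is `L⁺_v`-LINEAR, hence a homeomorphism

Cell `hodgecm-mathlib`, crux item hLiu418 = `stmt-HodgeConjecture-24832` (helper lane `--supports … --as helper`, count-neutral).  THEOREMS ONLY (no `def`, no instance,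
no notation, no named-fact hypothesis, no `sorry`).  PLACE-GENERIC doubled local currency of ★ κ₀.

WHY (LAST-FILE decomposition (K3); K2Liu-p08 (g4) 12:33:16Z «continuity from linearity at the call site»).  ★ (T2) along `κ` (★ (J) `integral_indicator_preimage_eq`) needs
`MeasurableSet (κ⁻¹ cell)`, and the witnesses `ΓΦ_ε = 𝟙_{κ⁻¹S₁²} − 𝟙_{κ⁻¹S₂²}` must be Schwartz–Bruhat (★ `indicator_mem_schwartzBruhat`: compact open sets); both follow once
`κ` is a HOMEOMORPHISM.  ★ κ-comp p860223 (K1) writes `κ` as `κ₀` followed by fixed matrix algebra (continuous both ways), so it suffices that `κ₀` (★ p860172: `φ`, inverse `ψ`)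
is bicontinuous: `φ` is `L⁺_v`-linear (`phi_smul` — `halfDiff`, `eD⁻¹`, `E′⁻¹`, `(·,0)` are) and a linear bijection of finite-dimensional Hausdorff topological `L⁺_v`-modules is
a homeomorphism (Mathlib `LinearEquiv.toContinuousLinearEquiv` over the complete non-archimedean field `L⁺_v`, `open scoped Valued` as ★ `quadraticLocalEquiv`).
* `phi_smul`;  ★★ **`exists_continuousLinearEquiv`** — `∃ κ : (Fin (n+n) → F_v) ≃L[F_v] (Fin n → LocalRing E v), κ = φ ∧ κ⁻¹ = ψ` pointwise;
* **`continuous_phi`**, **`continuous_psi`**;  `isCompact_preimage_phi`, `isOpen_preimage_phi`, `isClosed_preimage_phi` (the pulled-back boxes are compact ∕ open ∕ closed).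
[Weil1964, n° 11] [CasselsFrohlichANT1967, Ch. II §10] [Kudla1994, §3].
HONEST LABEL.  Count-neutral helper; `HC_CM` is proved only modulo the 7 printed citations (2 remaining named inputs: hLiu418 = `stmt-HodgeConjecture-24832`,
h413 = `stmt-HodgeConjecture-24833`) until rung 0 closes.

## References
* [Weil1964] A. Weil, Acta Math. 111 (1964), n° 11.
* [CasselsFrohlichANT1967] J. W. S. Cassels, A. Fröhlich (eds.), *Algebraic Number Theory* (1967), Ch. II §10.
* [Kudla1994] S. S. Kudla, Israel J. Math. 87 (1994), §3.
-/

set_option autoImplicit false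
set_option linter.dupNamespace false -- the mandated namespace repeats `HodgeConjecture.HodgeConjecture`

noncomputable section

open NumberField IsDedekindDomain Matrix
open Literature.RepresentationTheory.HeisenbergGroup Literature.RepresentationTheory.HeisenbergGroup.SymplecticMatrix
open Literature.NumberTheory.Automorphic Literature.NumberTheory.Automorphic.UnitaryGroup Literature.NumberTheory.Weil1964
open Literature.NumberTheory.GelbartRogawski1991.AdaptedBlocks
open Literature.NumberTheory.GelbartRogawski1991.UnitaryDualPair Literature.NumberTheory.GelbartRogawski1991.UnitaryDualPair.LocalSplitting

namespace Summit.HodgeConjecture.HodgeConjecture.Cruxes.HLiu418.K2LiuYModelDeltaMinusCoordinateContinuous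

open K2LiuYModelDeltaMinusCoordinate

variable (F : Type) [Field F] [NumberField F] (E : Type) [Field E] [NumberField E] [Algebra F E]
  [Algebra.IsQuadraticExtension F E] (c : E ≃ₐ[F] E)
  {δ : E} (hcδ : c δ = -δ) (hδ : δ ≠ 0) {d : F} (hd : δ * δ = algebraMap F E d)
  (v : HeightOneSpectrum (𝓞 F)) (n : ℕ) {T₀ : Matrix (Fin n) (Fin n) F}
  (E' : LocalSp F (n + n) (gramD F n T₀) v)

omit [Algebra.IsQuadraticExtension F E] in
/-- `halfDiff` commutes with the `F_v`-action. [folklore] -/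
theorem halfDiff_smul (a : v.adicCompletion F) (u : Fin n ⊕ Fin n → LocalRing E v) : halfDiff (a • u) = a • halfDiff u := by
  unfold halfDiff
  rw [smul_comm a (⅟(2 : LocalRing E v)) (u ∘ Sum.inl - u ∘ Sum.inr)]
  congr 1
  funext i
  simp only [Function.comp_apply, Pi.sub_apply, Pi.smul_apply, smul_sub]

/-- **`φ` is `F_v`-homogeneous.** [cite: Weil1964, n° 11] -/
theorem phi_smul (a : v.adicCompletion F) (x : Fin (n + n) → v.adicCompletion F) :
    halfDiff ((eD F E c hcδ hδ hd v n).symm (toLin F v E'⁻¹ (a • x, 0))) = a • halfDiff ((eD F E c hcδ hδ hd v n).symm (toLin F v E'⁻¹ (x, 0))) := by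
  rw [← halfDiff_smul, ← LinearEquiv.map_smul, ← LinearMap.map_smul, Prod.smul_mk, smul_zero]

/-- **`κ₀` AS A CONTINUOUS LINEAR EQUIVALENCE** `(Fin (n+n) → F_v) ≃L[F_v] (Fin n → E ⊗ F_v)` with `κ₀ = φ`, `κ₀⁻¹ = ψ` pointwise. [cite: Weil1964, n° 11] [cite: CasselsFrohlichANT1967, Ch. II §10] -/
theorem exists_continuousLinearEquiv (hE' : (deltaLagrangian F v n).map (toLin F v E') = lagrangianY F (n + n) v) :
    ∃ κ : (Fin (n + n) → v.adicCompletion F) ≃L[v.adicCompletion F] (Fin n → LocalRing E v),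
      (∀ x, κ x = halfDiff ((eD F E c hcδ hδ hd v n).symm (toLin F v E'⁻¹ (x, 0)))) ∧
      ∀ b, κ.symm b = (toLin F v E' (eD F E c hcδ hδ hd v n (adblV b))).1 := by
  let κ : (Fin (n + n) → v.adicCompletion F) ≃ₗ[v.adicCompletion F] (Fin n → LocalRing E v) :=
    { toFun := fun x => halfDiff ((eD F E c hcδ hδ hd v n).symm (toLin F v E'⁻¹ (x, 0)))
      invFun := fun b => (toLin F v E' (eD F E c hcδ hδ hd v n (adblV b))).1
      map_add' := fun x y => phi_add F E c hcδ hδ hd v n E' x y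
      map_smul' := fun a x => phi_smul F E c hcδ hδ hd v n E' a x
      left_inv := fun x => psi_phi F E c hcδ hδ hd v n E' hE' x
      right_inv := fun b => phi_psi F E c hcδ hδ hd v n E' hE' b }
  open scoped Valued in
  exact ⟨κ.toContinuousLinearEquiv, fun x => rfl, fun b => rfl⟩

/-- **`φ` is continuous.** [cite: Weil1964, n° 11] -/
theorem continuous_phi (hE' : (deltaLagrangian F v n).map (toLin F v E') = lagrangianY F (n + n) v) :
    Continuous fun x : Fin (n + n) → v.adicCompletion F => halfDiff ((eD F E c hcδ hδ hd v n).symm (toLin F v E'⁻¹ (x, 0))) := by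
  obtain ⟨κ, hκ, -⟩ := exists_continuousLinearEquiv F E c hcδ hδ hd v n E' hE'
  have e : (fun x : Fin (n + n) → v.adicCompletion F => halfDiff ((eD F E c hcδ hδ hd v n).symm (toLin F v E'⁻¹ (x, 0)))) = κ := funext fun x => (hκ x).symm
  rw [e]
  exact κ.continuous

/-- **`ψ` is continuous.** [cite: Weil1964, n° 11] -/
theorem continuous_psi (hE' : (deltaLagrangian F v n).map (toLin F v E') = lagrangianY F (n + n) v) :
    Continuous fun b : Fin n → LocalRing E v => (toLin F v E' (eD F E c hcδ hδ hd v n (adblV b))).1 := by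
  obtain ⟨κ, -, hκ⟩ := exists_continuousLinearEquiv F E c hcδ hδ hd v n E' hE'
  have e : (fun b : Fin n → LocalRing E v => (toLin F v E' (eD F E c hcδ hδ hd v n (adblV b))).1) = κ.symm := funext fun b => (hκ b).symm
  rw [e]
  exact κ.symm.continuous

/-- pulled-back COMPACT sets are compact: `φ⁻¹(W) = ψ(W)`. [cite: CasselsFrohlichANT1967, Ch. II §10] -/
theorem isCompact_preimage_phi (hE' : (deltaLagrangian F v n).map (toLin F v E') = lagrangianY F (n + n) v) {W : Set (Fin n → LocalRing E v)} (hW : IsCompact W) :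
    IsCompact ((fun x : Fin (n + n) → v.adicCompletion F => halfDiff ((eD F E c hcδ hδ hd v n).symm (toLin F v E'⁻¹ (x, 0)))) ⁻¹' W) := by
  obtain ⟨κ, hκ, -⟩ := exists_continuousLinearEquiv F E c hcδ hδ hd v n E' hE'
  have e : (fun x : Fin (n + n) → v.adicCompletion F => halfDiff ((eD F E c hcδ hδ hd v n).symm (toLin F v E'⁻¹ (x, 0)))) = κ := funext fun x => (hκ x).symm
  rw [e]
  exact κ.toHomeomorph.isCompact_preimage.2 hW

/-- pulled-back OPEN sets are open. [folklore] -/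
theorem isOpen_preimage_phi (hE' : (deltaLagrangian F v n).map (toLin F v E') = lagrangianY F (n + n) v) {W : Set (Fin n → LocalRing E v)} (hW : IsOpen W) :
    IsOpen ((fun x : Fin (n + n) → v.adicCompletion F => halfDiff ((eD F E c hcδ hδ hd v n).symm (toLin F v E'⁻¹ (x, 0)))) ⁻¹' W) :=
  hW.preimage (continuous_phi F E c hcδ hδ hd v n E' hE')

/-- pulled-back CLOSED sets are closed. [folklore] -/
theorem isClosed_preimage_phi (hE' : (deltaLagrangian F v n).map (toLin F v E') = lagrangianY F (n + n) v) {W : Set (Fin n → LocalRing E v)} (hW : IsClosed W) :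
    IsClosed ((fun x : Fin (n + n) → v.adicCompletion F => halfDiff ((eD F E c hcδ hδ hd v n).symm (toLin F v E'⁻¹ (x, 0)))) ⁻¹' W) :=
  hW.preimage (continuous_phi F E c hcδ hδ hd v n E' hE')

end Summit.HodgeConjecture.HodgeConjecture.Cruxes.HLiu418.K2LiuYModelDeltaMinusCoordinateContinuous

end
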